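import Summits.QuantumFields.YangMills.Theorems.ToronSmallBallSiteTwist
import HarnessLib

/-!
# Sheet translates by DIFFERENT elements on consecutive slices: the time-like defect is one commutator-type term per sheet link

Support module for the translate cruxes of seat ym-idea-4's LINE g12-A/B (`ToronSmallBall.ToronCoreRaritySubQuartic` ⟨stmt-QuantumFields-23956⟩ case (α),
`OffCoreStripWindowDeep` ⟨23957⟩, `QuantileBitPurity.HolonomyQuantileSubQuartic` ⟨23948⟩, `HolonomyLevyWindowDeep` ⟨23949⟩; memo HOME
`bc/g12-A/PLAN-X1-v2-gauss.md` §2 (α): «axis stability across slices … ⇒ temporal cost»).  When consecutive slices are translated by slice-dependent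
elements `h ≠ h'` (each slice by its own covariant axis), the time-like coupling is no longer exactly invariant (`timeCoupling_siteTwist_siteTwist` is the
case `h = h'`); the defect is EXACTLY a sum over sheet links of `Re tr ρ(W·(h'(x)⁻¹h(x))) − Re tr ρ(W)`, `W = UₑVₑ⁻¹`, and each term is at most
`√N ‖ρ(h x) − ρ(h' x)‖_F` for a unitary representation:

* `timeCoupling_siteTwist_siteTwist_sub` — the exact defect formula;
* ★ `abs_re_trace_timeDefect_le` — `|Re tr ρ(h W h'⁻¹) − Re tr ρ(W)| ≤ √N ‖ρ h − ρ h'‖_F` (unitary `ρ`);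
* `abs_timeCoupling_siteTwist_siteTwist_sub_le` — `|Δ timeCoupling| ≤ √N Σ_{sheet links (x,k)} ‖ρ(h x) − ρ(h' x)‖_F`.

HONEST FRAMING: exact fixed-lattice identities and a Cauchy–Schwarz trace inequality; nothing about infinite volume, the continuum limit or the Clay gap.
No `sorry`, no new axiom, no new definition.  References: [cite: tHooft1979]; [cite: SeilerLNP1982, §3]; [cite: Luscher1983, §2].
-/

set_option autoImplicit false

noncomputable section

open MeasureTheory
open Literature.MathematicalPhysics.QuantumFieldTheory
open Literature.MathematicalPhysics.QuantumLattice
open scoped BigOperators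

namespace Summit.QuantumFields.YangMills.Theorems.FemtoTransferGap

variable {N : ℕ} {G : Type*} [Group G] (ρ : G →* Matrix (Fin N) (Fin N) ℂ) {L : ℕ} [NeZero L]

/-- **Exact time-like defect of mismatched sheet translates**: translating the slice `U` by `h` and the slice `V` by `h'`,
`timeCoupling(siteTwist h U, siteTwist h' V) − timeCoupling(U, V) = Σ_{e on the sheet} (Re tr ρ(UₑVₑ⁻¹ · (h'(x)⁻¹ h(x))) − Re tr ρ(UₑVₑ⁻¹))`
(trace cyclicity moves `h(x)` to the right). [cite: tHooft1979] [cite: SeilerLNP1982, §3] -/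
theorem timeCoupling_siteTwist_siteTwist_sub (k : Fin 3) (h h' : Site 3 L → G) (U V : GaugeConfig 3 L G) :
    timeCoupling ρ (siteTwist k h U) (siteTwist k h' V) - timeCoupling ρ U V =
      ∑ e ∈ Finset.univ.filter (fun e : Edge 3 L => e.2 = k ∧ e.1 k = 0),
        ((ρ (U e * (V e)⁻¹ * ((h' e.1)⁻¹ * h e.1))).trace.re - (ρ (U e * (V e)⁻¹)).trace.re) := by
  unfold timeCoupling
  rw [← Finset.sum_sub_distrib]
  -- termwise: off the sheet the difference vanishes, on the sheet it is the defect
  have hterm : ∀ e : Edge 3 L, (ρ (siteTwist k h U e * (siteTwist k h' V e)⁻¹)).trace.re - (ρ (U e * (V e)⁻¹)).trace.re =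
      if e.2 = k ∧ e.1 k = 0 then (ρ (U e * (V e)⁻¹ * ((h' e.1)⁻¹ * h e.1))).trace.re - (ρ (U e * (V e)⁻¹)).trace.re else 0 := by
    intro e
    by_cases he : e.2 = k ∧ e.1 k = 0
    · rw [if_pos he, siteTwist_apply, siteTwist_apply, if_pos he, if_pos he]
      congr 2
      rw [mul_inv_rev, show h e.1 * U e * ((V e)⁻¹ * (h' e.1)⁻¹) = h e.1 * (U e * (V e)⁻¹ * (h' e.1)⁻¹) by simp only [mul_assoc],
        map_mul, Matrix.trace_mul_comm, ← map_mul]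
      congr 2
      simp only [mul_assoc]
    · rw [if_neg he, siteTwist_apply, siteTwist_apply, if_neg he, if_neg he, sub_self]
  simp only [hterm]
  rw [Finset.sum_filter]

variable (hρu : ∀ g, ρ g ∈ Matrix.unitaryGroup (Fin N) ℂ)

include hρu in
/-- ★ **One mismatched link costs at most `√N ‖ρ h − ρ h'‖_F`**: for a unitary representation and any `W`,
`|Re tr ρ(W · (h'⁻¹ h)) − Re tr ρ(W)| ≤ √N · ‖ρ h − ρ h'‖_F`. [folklore] -/
theorem abs_re_trace_timeDefect_le (W h h' : G) :
    |(ρ (W * (h'⁻¹ * h))).trace.re - (ρ W).trace.re| ≤ Real.sqrt N * frobNorm (ρ h - ρ h') := by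
  have hcs : ∀ X Y : Matrix (Fin N) (Fin N) ℂ, |X.trace.re - Y.trace.re| ≤ Real.sqrt N * frobNorm (X - Y) := fun X Y => by
    have h1 : frobNorm (1 : Matrix (Fin N) (Fin N) ℂ) = Real.sqrt N := by
      rw [← Real.sqrt_sq (frobNorm_nonneg _), frobNorm_sq_of_mem_unitaryGroup (Submonoid.one_mem _), Fintype.card_fin]
    have := abs_re_trace_mul_le (1 : Matrix (Fin N) (Fin N) ℂ) (X - Y)
    rwa [one_mul, h1, Matrix.trace_sub, Complex.sub_re] at this
  refine (hcs _ _).trans (mul_le_mul_of_nonneg_left ?_ (Real.sqrt_nonneg _))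
  have e1 : ρ (W * (h'⁻¹ * h)) - ρ W = ρ W * (ρ (h'⁻¹ * h) - 1) := by
    rw [map_mul, Matrix.mul_sub, Matrix.mul_one]
  rw [e1, frobNorm_unitary_mul (hρu W)]
  -- `‖ρ(h'⁻¹h) − 1‖ = ‖ρ h'⁻¹ (ρ h − ρ h')‖ = ‖ρ h − ρ h'‖`
  have e2 : ρ (h'⁻¹ * h) - 1 = ρ h'⁻¹ * (ρ h - ρ h') := by
    rw [Matrix.mul_sub, ← map_mul, ← map_mul, inv_mul_cancel, map_one]
  rw [e2, frobNorm_unitary_mul (hρu h'⁻¹)]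

include hρu in
/-- **The time-like defect of mismatched sheet translates is at most `√N Σ_{sheet links} ‖ρ(h x) − ρ(h' x)‖_F`** («axis stability across slices»,
PLAN-X1 v2 §2 (α)). [cite: tHooft1979] [cite: Luscher1983, §2] -/
theorem abs_timeCoupling_siteTwist_siteTwist_sub_le (k : Fin 3) (h h' : Site 3 L → G) (U V : GaugeConfig 3 L G) :
    |timeCoupling ρ (siteTwist k h U) (siteTwist k h' V) - timeCoupling ρ U V| ≤
      Real.sqrt N * ∑ e ∈ Finset.univ.filter (fun e : Edge 3 L => e.2 = k ∧ e.1 k = 0), frobNorm (ρ (h e.1) - ρ (h' e.1)) := by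
  rw [timeCoupling_siteTwist_siteTwist_sub, Finset.mul_sum]
  refine (Finset.abs_sum_le_sum_abs _ _).trans (Finset.sum_le_sum fun e _ => ?_)
  exact abs_re_trace_timeDefect_le ρ hρu (U e * (V e)⁻¹) (h e.1) (h' e.1)

end Summit.QuantumFields.YangMills.Theorems.FemtoTransferGap

end
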